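import Literature.Analysis.FluidPDE.CompressibleEulerImplosionChannelPiece
import HarnessLib

/-!
# Chains of graph-channel pieces

Topic `Literature/Analysis/FluidPDE`; namespace
`Literature.Analysis.FluidPDE.BuckmasterCaolaboraGomezserrano2025.ODE`. Companion of
`CompressibleEulerImplosionChannelPiece.lean` (one piece: `exists_exit_of_piece_of_subset`), used by
the computer-assisted part of the `γ = 5/3` shooting argument of T. Buckmaster, G. Cao-Labora,
J. Gómez-Serrano, *Smooth imploding solutions for 3D compressible fluids*, Forum Math. Pi 13
(2025) e6, arXiv:2208.09445 (named fact `BuckmasterCaolaboraGomezserrano2025_thm11_monatomic`).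

A trajectory of a planar `C¹` field is followed through a finite *chain* of graph-channel pieces in
one linear chart `(u, v)`: consecutive pieces `P`, `Q` share the breakpoint `Q.ua = P.ub` and the
entry face of `Q` strictly contains the exit face of `P` (`Junction`). Starting inside the first
piece the trajectory runs through all of them and reaches the exit face `u = ub` of the last one,
staying inside the union (`exists_exit_of_chain`). This is the form in which the validated
enclosures of the branch through `P_s` (the rôle played in the paper by the far barriers of
Props. 3.1, 4.1 and App. B) are consumed. Also: gluing of two consecutive solution segments
(`exists_glue_Icc`).

[cite: BuckmasterCaolaboraGomezserrano2025, Prop. 3.1, Prop. 4.1, Appendix B]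
-/

noncomputable section

open Set Filter Topology

namespace Literature.Analysis.FluidPDE

namespace BuckmasterCaolaboraGomezserrano2025

namespace ODE

/-! ### Gluing two solution segments -/

section Glue

variable {E : Type*} [NormedAddCommGroup E] [NormedSpace ℝ E] {F : E → E}

/-- **Concatenation of two forward solution segments** of an autonomous equation: `x₁` on `[0, T₁]`
followed by `x₂` on `[0, T₂]` with `x₂(0) = x₁(T₁)`. [folklore] -/
theorem exists_glue_Icc {x₁ x₂ : ℝ → E} {T₁ T₂ : ℝ} (hT₁ : 0 ≤ T₁) (hT₂ : 0 ≤ T₂)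
    (h₁ : ∀ t ∈ Icc 0 T₁, HasDerivAt x₁ (F (x₁ t)) t)
    (h₂ : ∀ t ∈ Icc 0 T₂, HasDerivAt x₂ (F (x₂ t)) t) (hj : x₂ 0 = x₁ T₁) :
    ∃ x : ℝ → E, (∀ t, t ≤ T₁ → x t = x₁ t) ∧ (∀ s, 0 < s → x (T₁ + s) = x₂ s) ∧
      x (T₁ + T₂) = x₂ T₂ ∧ ∀ t ∈ Icc 0 (T₁ + T₂), HasDerivAt x (F (x t)) t := by
  set α : ℝ → E := fun t => x₂ (t - T₁) with hα
  set x : ℝ → E := fun t => if t ≤ T₁ then x₁ t else α t with hx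
  have hxl : ∀ t, t ≤ T₁ → x t = x₁ t := fun t ht => by simp only [hx, if_pos ht]
  have hxr : ∀ s, 0 < s → x (T₁ + s) = x₂ s := fun s hs => by
    simp only [hx, hα, if_neg (show ¬ (T₁ + s ≤ T₁) by linarith)]
    congr 1; ring
  have hαd : ∀ t, t - T₁ ∈ Icc 0 T₂ → HasDerivAt α (F (α t)) t := fun t ht => by
    have h := (h₂ (t - T₁) ht).comp_sub_const t T₁
    simpa [hα] using h
  refine ⟨x, hxl, hxr, ?_, fun t ht => ?_⟩
  · rcases eq_or_lt_of_le hT₂ with h | h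
    · rw [← h, add_zero, hxl T₁ le_rfl, ← hj]
    · exact hxr T₂ h
  rcases lt_trichotomy t T₁ with hlt | heq | hgt
  · -- left of the junction: `x = x₁` near `t`
    have hev : x =ᶠ[𝓝 t] x₁ :=
      (eventually_lt_nhds hlt).mono fun s hs => hxl s hs.le
    rw [hxl t hlt.le]
    exact (h₁ t ⟨ht.1, hlt.le⟩).congr_of_eventuallyEq hev
  · -- at the junction
    subst heq
    have hc : HasDerivAt x₁ (F (x₁ t)) t := h₁ t ⟨ht.1, le_rfl⟩
    have hαt : HasDerivAt α (F (α t)) t := hαd t (by simp [hT₂])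
    have h0 : α t = x₁ t := by simp [hα, hj]
    have h := hasDerivAt_glue (F := F) hc hαt h0
    rw [hxl t le_rfl]
    exact h
  · -- right of the junction: `x = α` near `t`
    have hev : x =ᶠ[𝓝 t] α :=
      (eventually_gt_nhds hgt).mono fun s hs => by simp only [hx, if_neg (not_le.mpr hs)]
    have hxt : x t = α t := by simp only [hx, if_neg (not_le.mpr hgt)]
    rw [hxt]
    exact (hαd t ⟨by linarith, by linarith [ht.2]⟩).congr_of_eventuallyEq hev

end Glue

/-! ### Chains of pieces -/

/-- The data of one graph-channel piece: `u`-range and the two walls with their derivatives.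
[folklore] -/
structure PieceData where
  /-- left end of the `u`-range -/
  ua : ℝ
  /-- right end of the `u`-range -/
  ub : ℝ
  /-- upper wall -/
  fL : ℝ → ℝ
  /-- lower wall -/
  fR : ℝ → ℝ
  /-- derivative of the upper wall -/
  fL' : ℝ → ℝ
  /-- derivative of the lower wall -/
  fR' : ℝ → ℝ

/-- The hypotheses of `exists_exit_of_piece_of_subset` for one piece: inflow through both walls,
progress `u̇ > 0` on the closed piece, and the piece lies in the set `U` where the field is `C¹`.
[cite: BuckmasterCaolaboraGomezserrano2025, Prop. 3.1, Prop. 4.1 (barrier conditions)] -/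
structure PieceOK (F : ℝ × ℝ → ℝ × ℝ) (U : Set (ℝ × ℝ)) (ch : LinChart) (P : PieceData) : Prop where
  hab : P.ua < P.ub
  hfL : ∀ u, HasDerivAt P.fL (P.fL' u) u
  hfR : ∀ u, HasDerivAt P.fR (P.fR' u) u
  wallL : ∀ p : ℝ × ℝ, ch.u p ∈ Icc P.ua P.ub → ch.v p = P.fL (ch.u p) →
    ch.v (F p) - P.fL' (ch.u p) * ch.u (F p) < 0
  wallR : ∀ p : ℝ × ℝ, ch.u p ∈ Icc P.ua P.ub → ch.v p = P.fR (ch.u p) →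
    0 < ch.v (F p) - P.fR' (ch.u p) * ch.u (F p)
  prog : ∀ p ∈ piece ch P.ua P.ub P.fL P.fR, 0 < ch.u (F p)
  sub : piece ch P.ua P.ub P.fL P.fR ⊆ U

/-- Consecutive pieces: common breakpoint, and the entry face of `Q` strictly contains the exit
face of `P`. [folklore] -/
def Junction (P Q : PieceData) : Prop :=
  Q.ua = P.ub ∧ Q.fR Q.ua < P.fR P.ub ∧ P.fL P.ub < Q.fL Q.ua

/-- "`p` is strictly inside the piece `Q` over the half-open `u`-range, or on its exit face":
`u ∈ [ua, ub]` and `fR(u) < v < fL(u)`. [folklore] -/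
def InPiece (ch : LinChart) (Q : PieceData) (p : ℝ × ℝ) : Prop :=
  ch.u p ∈ Icc Q.ua Q.ub ∧ Q.fR (ch.u p) < ch.v p ∧ ch.v p < Q.fL (ch.u p)

/-- **Running through a chain of pieces.** [cite: BuckmasterCaolaboraGomezserrano2025, Prop. 3.1, Prop. 4.1, Appendix B] -/
theorem exists_exit_of_chain {F : ℝ × ℝ → ℝ × ℝ} {U : Set (ℝ × ℝ)} (hU : IsOpen U)
    (hF : ∀ x ∈ U, ContDiffAt ℝ 1 F x) {ch : LinChart} (hdet : ch.a * ch.d - ch.b * ch.c ≠ 0) :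
    ∀ (l : List PieceData) (P : PieceData), (∀ Q ∈ P :: l, PieceOK F U ch Q) →
      List.IsChain Junction (P :: l) →
      ∀ p₀ : ℝ × ℝ, ch.u p₀ ∈ Ico P.ua P.ub →
        P.fR (ch.u p₀) < ch.v p₀ ∧ ch.v p₀ < P.fL (ch.u p₀) →
      ∃ T > (0 : ℝ), ∃ x : ℝ → ℝ × ℝ, x 0 = p₀ ∧ (∀ t ∈ Icc 0 T, HasDerivAt x (F (x t)) t) ∧
        (∀ t ∈ Icc 0 T, ∃ Q ∈ P :: l, InPiece ch Q (x t)) ∧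
        InPiece ch ((P :: l).getLast (List.cons_ne_nil P l)) (x T) ∧
        ch.u (x T) = ((P :: l).getLast (List.cons_ne_nil P l)).ub := by
  intro l
  induction l with
  | nil =>
    intro P hOK _ p₀ hu₀ hv₀
    have hP := hOK P (by simp)
    obtain ⟨T, hT, x, hx0, hxd, hxin, hxT⟩ := exists_exit_of_piece_of_subset hU hF hdet hP.hab
      hP.hfL hP.hfR hP.wallL hP.wallR hP.prog hP.sub hu₀ hv₀
    refine ⟨T, hT, x, hx0, hxd, fun t ht => ⟨P, by simp, hxin t ht⟩, ?_, ?_⟩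
    · exact hxin T ⟨hT.le, le_rfl⟩
    · simpa using hxT
  | cons Q l ih =>
    intro P hOK hch p₀ hu₀ hv₀
    have hP := hOK P (by simp)
    have hPQ : Junction P Q := (List.isChain_cons_cons.1 hch).1
    have hch' : List.IsChain Junction (Q :: l) := (List.isChain_cons_cons.1 hch).2
    obtain ⟨T₁, hT₁, x₁, hx0, hxd, hxin, hxT⟩ := exists_exit_of_piece_of_subset hU hF hdet hP.hab
      hP.hfL hP.hfR hP.wallL hP.wallR hP.prog hP.sub hu₀ hv₀
    -- the exit point of `P` is an admissible starting point of `Q`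
    have hQ := hOK Q (by simp)
    obtain ⟨-, hR1, hL1⟩ := hxin T₁ ⟨hT₁.le, le_rfl⟩
    have hu₁ : ch.u (x₁ T₁) ∈ Ico Q.ua Q.ub := by
      rw [hxT, ← hPQ.1]; exact ⟨le_rfl, hQ.hab⟩
    have hv₁ : Q.fR (ch.u (x₁ T₁)) < ch.v (x₁ T₁) ∧ ch.v (x₁ T₁) < Q.fL (ch.u (x₁ T₁)) := by
      rw [hxT] at hR1 hL1 ⊢
      rw [← hPQ.1]
      exact ⟨hPQ.2.1.trans hR1, hL1.trans hPQ.2.2⟩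
    obtain ⟨T₂, hT₂, x₂, hx₂0, hx₂d, hx₂in, hx₂last, hx₂T⟩ :=
      ih Q (fun Q' hQ' => hOK Q' (List.mem_cons_of_mem P hQ')) hch' (x₁ T₁) hu₁ hv₁
    obtain ⟨x, hxl, hxr, hxend, hd⟩ := exists_glue_Icc (F := F) hT₁.le hT₂.le hxd hx₂d hx₂0
    have hlast : (P :: Q :: l).getLast (List.cons_ne_nil P (Q :: l)) =
        (Q :: l).getLast (List.cons_ne_nil Q l) := by simp
    refine ⟨T₁ + T₂, by linarith, x, by rw [hxl 0 hT₁.le, hx0], hd, fun t ht => ?_, ?_, ?_⟩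
    · rcases le_or_gt t T₁ with h | h
      · rw [hxl t h]
        exact ⟨P, by simp, hxin t ⟨ht.1, h⟩⟩
      · obtain ⟨Q', hQ', hin⟩ := hx₂in (t - T₁) ⟨by linarith, by linarith [ht.2]⟩
        refine ⟨Q', List.mem_cons_of_mem P hQ', ?_⟩
        have e : x t = x₂ (t - T₁) := by
          have := hxr (t - T₁) (by linarith); rwa [add_sub_cancel] at this
        rwa [e]
    · rw [hlast, hxend]; exact hx₂last
    · rw [hlast, hxend]; exact hx₂T

end ODE

end BuckmasterCaolaboraGomezserrano2025

end Literature.Analysis.FluidPDE
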